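import Literature.AlgebraicGeometry.AbelianSchemes.MumfordDualUniversalityAnyChar
import Literature.AlgebraicGeometry.AbelianSchemes.MumfordQuotientConstructionAnyChar
import Literature.AlgebraicGeometry.AbelianSchemes.LevelBasisCoverFreeQuotientOfInvertibleLevel
import Literature.AlgebraicGeometry.AbelianSchemes.AbelianSchemeKOfLConstantOfLevelCover
import Literature.AlgebraicGeometry.AbelianSchemes.AbelianSchemeRelDimOfConnected
import Literature.AlgebraicGeometry.AbelianSchemes.AbelianSchemeBaseChangeActionOver
import Literature.AlgebraicGeometry.AbelianSchemes.AbelianSchemeKOfLSeesaw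
import Literature.AlgebraicGeometry.AbelianSchemes.LevelStructureLocus
import Literature.AlgebraicGeometry.AbelianSchemes.DualPairBaseQuotientDescent
import Literature.AlgebraicGeometry.AbelianSchemes.DualPairBaseQuotientDescentOfNoetherian
import Literature.AlgebraicGeometry.AbelianSchemes.DualPairHatActionOfBaseChangeSquares
import Literature.AlgebraicGeometry.AbelianSchemes.AbelianSchemeBaseQuotientDescentOfAffineBase
import Literature.AlgebraicGeometry.AbelianSchemes.AbelianSchemeDualPairNormalize
import Literature.AlgebraicGeometry.Morphisms.ProjectiveMorphismComposition
import HarnessLib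

/-!
# Mumford's dual abelian scheme `(A⁄K(L), 𝒫)` over a CONNECTED Noetherian affine base, in ANY characteristic — the F-3 (M) closer OFF `ℚ`
# ([MumfordAV1970] §13 Theorem p. 125; [MumfordFogartyKirwan1994] Ch. 6 §1 Cor. 6.8, §2 Prop. 6.13)

Layer `Literature/AlgebraicGeometry/AbelianSchemes`, namespace `Literature.AlgebraicGeometry.AbelianSchemes.MumfordDual`.  THEOREMS ONLY (no
definition, no named fact, no instance, no notation, no `sorry`).  Cell `hodgecm-mathlib` (D-0151), P6 «MOD programme», L4 DUALS road (LEAD F0P6-plan (g3)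
«M-55c»; LA4-p05 (g0)), road (A) re-thread file **O3d = (M)** (★ `Theorems/F3DualAbelianSchemeStubM` + `…MStubMa` off `ℚ`): the Summits composition re-run
VERBATIM over ANY connected Noetherian affine base, `[Algebra ℚ R]` replaced by an exponent `n` INVERTIBLE on the base with `i ^ n = 1` for the finite étale
`i : K(L) ↪ A` (the output of ★ (K′) `exists_kOfL_etale_of_isUnit`), every other input an any-characteristic ★: (Ma′) `exists_connected_levelCover_free_geometricQuotient_of_isUnit`,
★ `exists_finite_subgroup_memKOfL_iff_baseChange`, (Mb′) `exists_quotient_poincare_of_constant_kOfL_baseChange_of_isLocallyNoetherian`, (Mc′)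
`MumfordDual.existsUnique_classify`, (Md1)–(Md3) ★ `DualPair.exists_actionOver_hat_of_isBaseChangeVia` ∕ `exists_abelianScheme_desc_of_forall_finset` ∕
`exists_dualPair_fields_of_free_base_quotient'` (never used `ℚ`).

* §1 **`exists_split_kOfL_of_isUnit`** — (Ma): `K(L)` splits as a constant finite subgroup `K′` of sections over a connected affine finite étale surjective
  free base quotient `p : S′ → Spec R` (the connected level-`n`-basis cover);
* §2 private wrappers (Md1)(Md2)(Md3) of the three ★ descent letters;
* §3 **`nonempty_dualPair_of_isProjective_of_split`** — THE (M) HEAD: a PROJECTIVE abelian scheme over a connected Noetherian ring `R`, with `L` rank one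
  rigidified fibrewise of ample class, `n ∈ R^×` and `K(L)` represented by a finite étale `i` with `i ^ n = 1`, HAS A ★ `DualPair`.

Sequel (the road-(A) head): `DualPairOfAmpleRigidified.lean` — the re-typed socket `stub_DUALS` over any Noetherian ring by ★ (K′) + this + ★
`exists_connected_affine_nbhd` + the (Z) glue.  HC_CM is proved only modulo the printed citations (2 remaining named inputs hLiu418 24832, h413 24833)
until rung 0 closes; nothing here is about HC.

## References
* [MumfordAV1970] D. Mumford, *Abelian Varieties* (1970), §13 Theorem (p. 125), §12 Thm. 1 (p. 112), §7 Thm. p. 66, §23.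
* [MumfordFogartyKirwan1994] D. Mumford, J. Fogarty, F. Kirwan, *Geometric Invariant Theory*, 3rd ed. (1994), Ch. 6 §1 Cor. 6.4 (p. 117), Cor. 6.8 (p. 118),
  §2 (p. 121), Prop. 6.13 (iii) (p. 123); Ch. 7 §2 Prop. 7.3 step (IV) (pp. 133–134), §3 remark after Thm. 7.9 and Lemma 7.11 (pp. 139–140).
* [MilneAV2008] J. S. Milne, *Abelian Varieties* (2008), I §8 pp. 36–37.
* [SGA1] A. Grothendieck, *SGA 1*, Exp. V Prop. 2.6, Exp. VIII Cor. 7.8.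
-/

noncomputable section

open CategoryTheory CategoryTheory.Limits AlgebraicGeometry MonoidalCategory CartesianMonoidalCategory
open scoped MonObj
open Literature.AlgebraicGeometry.AbelianSchemes Literature.AlgebraicGeometry.RelativeSpec
  Literature.AlgebraicGeometry.Motives Literature.AlgebraicGeometry.AbelianVarieties Literature.AlgebraicGeometry.Modules
open Literature.AlgebraicGeometry.Morphisms (IsProjective)

namespace Literature.AlgebraicGeometry.AbelianSchemes

namespace MumfordDual

/-! ## §1 (Ma) in any characteristic: `K(L)` splits over a connected free finite base quotient -/

/-- **(Ma) in ANY characteristic — `K(L)` SPLITS OVER A CONNECTED FREE FINITE BASE QUOTIENT** ([MumfordAV1970] §23 (p. 231) with §7 Thm. p. 66: an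
étale finite subgroup scheme becomes constant after a finite étale surjective base change; [MumfordFogartyKirwan1994] Ch. 7 §2 Prop. 7.3 step (IV): the
level-`n`-basis cover).  For `A → Spec R` over a connected Noetherian ring, `L` rank one rigidified with ample fibre classes, `n ∈ R^×` and `K(L)`
represented by a finite étale `i` with `i ^ n = 1`: there are a connected affine Noetherian `S′`, a finite étale surjective `p : S′ → Spec R` which is a
free geometric quotient by a finite group acting on `A ×_R S′` compatibly, and a finite subgroup `K′` of sections of `A ×_R S′` injective on points with
«`u ∈ K(L_{S′})` iff `u` is a section of `K′` after every base change» (★ `exists_connected_levelCover_free_geometricQuotient_of_isUnit` + ★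
`exists_finite_subgroup_memKOfL_iff_baseChange`). [cite: MumfordAV1970, §23 (p. 231) and §7 Thm. (p. 66)] [cite: MumfordFogartyKirwan1994, Ch. 7 §2 Prop. 7.3 step (IV) (pp. 133–134)] -/
theorem exists_split_kOfL_of_isUnit : ∀ (R : Type) [CommRing R] [IsNoetherianRing R] [ConnectedSpace ↥(Spec (.of R))]
    (A : AbelianSchemeOver (Spec (.of R)))
    (L : A.left.Modules) (hL : HasRank L 1)
    (_hε : CechPic.pullback A.unitSection (detClass (HasRank.isFiniteLocallyFree' hL)) = 1)
    (_hΘ : ∀ ⦃Ω : Type⦄ [Field Ω] [IsAlgClosed Ω] (s : Spec (.of Ω) ⟶ Spec (.of R)),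
      ∃ Θ : CartierDivisor (A.fibre s).toAbelianVariety.X.left, Θ.IsAmple ∧
        CechPic.pullback (X := (A.fibre s).toAbelianVariety.X.left) (pullback.fst A.X.hom s)
          (detClass (HasRank.isFiniteLocallyFree' hL)) = Θ.cechClass)
    (n : ℕ) [NeZero n] (_hn : IsUnit ((n : ℕ) : R))
    (_hK : ∃ (Z : Over (Spec (.of R))) (i : Z ⟶ A.X) (_ : IsClosedImmersion i.left) (_ : IsFinite Z.hom) (_ : Etale Z.hom),
      i ^ n = 1 ∧ ∀ (T : Over (Spec (.of R))) (u : T ⟶ A.X), (∃ v : T ⟶ Z, v ≫ i = u) ↔ A.MemKOfL L u),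
    ∃ (S' : Scheme.{0}) (p : S' ⟶ Spec (.of R)) (_ : IsAffine S') (_ : IsLocallyNoetherian S') (_ : IsAffineHom p)
      (_ : IsFinite p) (_ : LocallyOfFiniteType p) (_ : Etale p) (_ : Surjective p)
      (G : Type) (_ : Group G) (_ : Fintype G) (ρ : ActionOver p G)
      (ρA : ActionOver (pullback.fst A.X.hom p) G) (_ : (A.baseChange p).IsBaseChangeVia A p (pullback.fst A.X.hom p))
      (_ : ∀ γ₀ : G, (A.baseChange p).IsBaseChangeVia (A.baseChange p) (ρ.aut γ₀).hom (ρA.aut γ₀).hom),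
      ρ.IsGeometricQuotient p ∧
      (∀ (V : (Spec (.of R)).Opens), IsAffineOpen V → ∀ γ₀ : G, γ₀ ≠ 1 →
        Ideal.span (Set.range fun s : Γ(S', p ⁻¹ᵁ V) ↦ ρ.act γ₀ V s - s) = ⊤) ∧
      ∃ (K' : Subgroup (A.baseChange p).Sections) (_ : Finite K'),
        (∀ (Ω : Type) [Field Ω] [IsAlgClosed Ω] (s : Spec (.of Ω) ⟶ S') (σ : (A.baseChange p).Sections), σ ∈ K' → σ ≠ 1 →
          (A.baseChange p).restrict s σ ≠ (A.baseChange p).restrict s 1) ∧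
        ∀ (T : Over S') (u : T ⟶ (A.baseChange p).X),
          (A.baseChange p).MemKOfL ((Scheme.Modules.pullback (pullback.fst A.X.hom p)).obj L) u ↔
            ∃ 𝒱 : Scheme.OpenCover.{0} T.left, ∀ j, ∃ σ : K',
              𝒱.f j ≫ u.left = 𝒱.f j ≫ T.hom ≫ (σ : (A.baseChange p).Sections).left := by
  intro R _ _ _ A L hL hε _hΘ n _ hn hK
  obtain ⟨Z, i, hci, hZfin, hZet, hin, hZ⟩ := hK
  haveI := hci
  haveI := hZfin
  haveI := hZet
  -- (G6) + (Ma0-conn): the connected level-`n` cover (`n` invertible on the base, ★ (Ma′))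
  obtain ⟨g, hg⟩ := A.exists_isOfRelDim
  obtain ⟨S', p, hAff, hconn, hAffHom, hpfin, hpet, hpsurj, G, iG, fG, ρ, hq, hfree, ⟨φ⟩⟩ :=
    A.exists_connected_levelCover_free_geometricQuotient_of_isUnit R hg n hn
  haveI := hAff
  haveI := hconn
  haveI := hAffHom
  haveI := hpfin
  haveI := hpet
  haveI := hpsurj
  letI := iG
  letI := fG
  -- (E7): the base-change action and its squares
  obtain ⟨ρA, -, -, hAB, hsq⟩ := AbelianSchemeOver.exists_actionOver_baseChange ρ A
  -- instances and the invertibility of `n` on `S′`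
  haveI : IsLocallyNoetherian S' := LocallyOfFiniteType.isLocallyNoetherian p
  have hM : ∀ s : S', (n : S'.residueField s) ≠ 0 :=
    AbelianSchemeOver.natCast_residueField_ne_zero_of_hom p (AbelianSchemeOver.natCast_residueField_spec_ne_zero_of_isUnit R hn)
  -- brick 4: the `K′`-clause
  obtain ⟨K', hK'fin, hK'free, hK'iff⟩ := A.exists_finite_subgroup_memKOfL_iff_baseChange L hL hε i hZ hin p hM φ
  exact ⟨S', p, hAff, inferInstance, hAffHom, hpfin, inferInstance, hpet, hpsurj, G, iG, fG, ρ, ρA, hAB, hsq, hq, hfree,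
    K', hK'fin, hK'free, hK'iff⟩


/-! ## §2 The three descent letters (Md1)(Md2)(Md3) over their ★ closers (private wrappers, statements of ★ `Theorems/F3DualAbelianSchemeStubM`) -/

/-- **letter (Md1) `stub_F3Md1`** — [MilneAV2008, I §8 (the dual pair is unique up to a unique isomorphism)] in the free-base-quotient
carrier: `p : S → Q = S/G` free (carrier of record), `A/S` the base change of `B/Q` along `p` with the covering action `ρA` by
isomorphisms of group schemes (`hAB`, `hA`), and `D = (Â, 𝒫)` a HAT-NORMALISED dual pair of `A` (`𝒫|_{A × {ε_Â}} ≅ 𝒪`, ★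
`DualPair.normalize`).  Then `G` acts on `Â` over `Â → S → Q`, covering `ρ` (`ρ̂(g)` over `ρ(g)`) by isomorphisms of group schemes,
with the POINCARÉ INVARIANCE clause `(ρA(g) × ρ̂(g))^*𝒫 ≅ 𝒫` for all `g` — exactly the inputs `ρh`/`hAh`/`hP` of (Md3).  Road: `ρ̂(g) :=`
★ `DualPair.hatTransportOfBaseChange D D (hA g)` (FILE A `AbelianSchemeDualTransportOfBaseChange`: the transport along a base-change
square, its Poincaré clause `nonempty_pullback_map_hatTransportOfBaseChange_iso`, uniqueness ⇒ multiplicativity, group-scheme clause ★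
`hat_isBaseChangeVia_hatTransportOfBaseChange_of_isLocallyNoetherian` under the unit hypothesis, or ★ `…OfBaseChangeAnyBase`).
[cite: MilneAV2008, I §8 pp. 36–37] [cite: MumfordFogartyKirwan1994, Ch. 6 §1 Cor. 6.4 (p. 117) and Ch. 7 §3 remark after Thm. 7.9 (p. 139)] -/
private theorem stub_F3Md1 : ∀ {S Q : Scheme.{0}} {p : S ⟶ Q} {G : Type} [Group G] [Fintype G] (ρ : ActionOver p G)
    (_hq : ρ.IsGeometricQuotient p) [IsAffineHom p]
    (_hfree : ∀ (V : Q.Opens), IsAffineOpen V → ∀ g : G, g ≠ 1 →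
      Ideal.span (Set.range fun s : Γ(S, p ⁻¹ᵁ V) ↦ ρ.act g V s - s) = ⊤)
    (A : AbelianSchemeOver S) (D : A.DualPair)
    (B : AbelianSchemeOver Q) {π : A.X.left ⟶ B.X.left} (ρA : ActionOver π G) (_hAB : A.IsBaseChangeVia B p π)
    (hA : ∀ g : G, A.IsBaseChangeVia A (ρ.aut g).hom (ρA.aut g).hom) [IsLocallyNoetherian S]
    (_unit : Nonempty ((Scheme.Modules.pullback (AbelianSchemeOver.DualPair.unitHatSlice D)).obj D.P ≅ SheafOfModules.unit _)),
    ∃ (ρh : ActionOver (D.hat.X.hom ≫ p) G) (_ : ∀ g : G, (ρh.aut g).hom ≫ D.hat.X.hom = D.hat.X.hom ≫ (ρ.aut g).hom)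
      (hAh : ∀ g : G, D.hat.IsBaseChangeVia D.hat (ρ.aut g).hom (ρh.aut g).hom),
      ∀ g : G, Nonempty ((Scheme.Modules.pullback
        (pullback.map A.X.hom D.hat.X.hom A.X.hom D.hat.X.hom (ρA.aut g).hom (ρh.aut g).hom (ρ.aut g).hom
          (hA g).fst.symm (hAh g).fst.symm)).obj D.P ≅ D.P) := by
  intro S Q p G _ _ ρ _ _ _ A D B π ρA _ hA _ hunit
  obtain ⟨ρh, -, hover, hAh, hP⟩ := AbelianSchemeOver.DualPair.exists_actionOver_hat_of_isBaseChangeVia ρ D ρA hA hunit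
  exact ⟨ρh, hover, hAh, hP⟩

/-- **letter (Md2) `stub_F3Md2`** — [SGA1, Exp. VIII Cor. 7.8 (effective descent of quasi-projective schemes)] in its cheapest,
free-finite-quotient form ([MumfordAV1970, §7 Thm. p. 66; §12 Thm. 1 (p. 112)]): `p : S → Q = S/G` a free finite base quotient (carrier
of record; `p` affine, locally of finite type; `S`, `Q` locally Noetherian, `Q` AFFINE — binder `[IsAffine Q]` added 19:19Z on B-p13 (g21)'s
closing over (E4) `exists_abelianScheme_desc_of_forall_finset`; the composition instantiates `Q := Spec R`), `X → S` an abelian scheme in which EVERY FINITE SET OF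
POINTS LIES IN AN AFFINE OPEN (quasi-projective over an affine base suffices — (Mb)'s last conjunct), with a `G`-action `ρX` over
`X → S → Q` covering `ρ` by isomorphisms of group schemes.  Then the quotient `X/G` is an ABELIAN SCHEME `B̂ → Q` with separated total
space, the quotient map `π̂ : X → B̂` is `G`-invariant and exhibits `X` as the base change of `B̂` along `p` as a group scheme.  Road:
`G`-stable affine cover (★ `forall_exists_mem_stableAffineOpens_of_orbit` pattern) ⇒ ★ `ActionOver.glued` / `isGeometricQuotient_gluedMk`
/ `isSeparated_gluedDesc` / `isProper_gluedDesc`; the group law, smoothness and geometric connectedness of `X/G → Q` descend because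
`X → X/G` is a base change of the finite étale `S → Q` (★ `GeometricQuotientFreeBaseChange`, `GeometricQuotientGroupLaw`; cartesian
square by ★ `isPullback_of_equivariant_of_free`).  New tree work (L−): the assembly «free quotient of an abelian scheme COVERING a free
base quotient is an abelian scheme over the quotient base» — the E-road ★ `AbelianSchemeBaseQuotientDescent` descends `A` when `B` is
GIVEN; here `B̂` is PRODUCED. [cite: SGA1, Exp. VIII Cor. 7.8] [cite: MumfordAV1970, §7 Thm. p. 66 and §12 Thm. 1 (p. 112)]
[cite: MumfordFogartyKirwan1994, Ch. 7 §3 remark after Thm. 7.9 (p. 139)] -/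
private theorem stub_F3Md2 : ∀ {S Q : Scheme.{0}} [IsAffine Q] {p : S ⟶ Q} {G : Type} [Group G] [Fintype G] (ρ : ActionOver p G)
    (_hq : ρ.IsGeometricQuotient p) [IsAffineHom p] [LocallyOfFiniteType p] [IsLocallyNoetherian S] [IsLocallyNoetherian Q]
    (_hfree : ∀ (V : Q.Opens), IsAffineOpen V → ∀ g : G, g ≠ 1 →
      Ideal.span (Set.range fun s : Γ(S, p ⁻¹ᵁ V) ↦ ρ.act g V s - s) = ⊤)
    (X : AbelianSchemeOver S) (_hfin : ∀ F : Finset X.X.left, ∃ U : X.X.left.Opens, IsAffineOpen U ∧ ∀ x ∈ F, x ∈ U)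
    (ρX : ActionOver (X.X.hom ≫ p) G) (_hρX : ∀ g : G, (ρX.aut g).hom ≫ X.X.hom = X.X.hom ≫ (ρ.aut g).hom)
    (_hX : ∀ g : G, X.IsBaseChangeVia X (ρ.aut g).hom (ρX.aut g).hom),
    ∃ (Bh : AbelianSchemeOver Q) (πh : X.X.left ⟶ Bh.X.left),
      (∀ g : G, (ρX.aut g).hom ≫ πh = πh) ∧ X.IsBaseChangeVia Bh p πh ∧ Bh.X.left.IsSeparated := by
  intro S Q _ p G _ _ ρ hq _ _ _ _ hfree X hfin ρX _ hX
  haveI : IsSeparated p := IsSeparated.of_isAffineHom p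
  obtain ⟨B, π, ρA, hρA, -, -, -, hsep, hbc⟩ :=
    AbelianSchemeOver.exists_abelianScheme_desc_of_forall_finset X ρX.aut hX hfin hq hfree
  refine ⟨B, π, fun g => ?_, hbc, hsep⟩
  rw [← hρA g]
  exact ρA.aut_comp g

/-- **letter (Md3) `stub_F3Md3`** = B-p13 (g21)'s (E3) ★ p793105 `exists_dualPair_fields_of_free_base_quotient′`
(`Literature/AlgebraicGeometry/AbelianSchemes/DualPairBaseQuotientDescentOfNoetherian.lean`; = ★
`DualPairBaseQuotientDescent.exists_dualPair_fields_of_free_base_quotient` with `[IsReduced D.hat.X.left]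
[IsLocallyNoetherian D.hat.X.left]` replaced by `[IsLocallyNoetherian S]`), statement copied token for token and closed by `∀`:
the dual pair `D` of `A/S` descends along the free finite base quotient `p : S → Q` to the four property fields of a dual pair of
`B/Q` on `(B̂, 𝒫_B)` together with the Poincaré clause `(π × π̂)^*𝒫_B ≅ 𝒫`.  Discharged BY NAME over (E3).
[cite: MumfordFogartyKirwan1994, Ch. 7 §3, remark after Thm. 7.9 and Lemma 7.11 (pp. 139–140)]
[cite: MumfordFogartyKirwan1994, Ch. 6 §1 Cor. 6.8 (p. 118) and §2 (p. 121)] [cite: MumfordAV1970, §13 (p. 125)]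
[cite: MilneAV2008, I §8 pp. 36–37] [cite: SGA1, Exp. VIII Cor. 7.8] -/
private theorem stub_F3Md3 : ∀ {S Q : Scheme.{0}} {p : S ⟶ Q} {G : Type} [Group G] [Fintype G] {ρ : ActionOver p G}
    (_hq : ρ.IsGeometricQuotient p) [IsAffineHom p]
    (_hfree : ∀ (V : Q.Opens), IsAffineOpen V → ∀ g : G, g ≠ 1 →
      Ideal.span (Set.range fun s : Γ(S, p ⁻¹ᵁ V) ↦ ρ.act g V s - s) = ⊤)
    (A : AbelianSchemeOver S) (D : A.DualPair)
    (B : AbelianSchemeOver Q) {π : A.X.left ⟶ B.X.left} (ρA : ActionOver π G) (hAB : A.IsBaseChangeVia B p π)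
    (hA : ∀ g : G, A.IsBaseChangeVia A (ρ.aut g).hom (ρA.aut g).hom)
    (Bh : AbelianSchemeOver Q) {πh : D.hat.X.left ⟶ Bh.X.left} (ρh : ActionOver πh G)
    (hABh : D.hat.IsBaseChangeVia Bh p πh)
    (hAh : ∀ g : G, D.hat.IsBaseChangeVia D.hat (ρ.aut g).hom (ρh.aut g).hom)
    [IsLocallyNoetherian S] [IsLocallyNoetherian Q] [LocallyOfFiniteType p] [Bh.X.left.IsSeparated]
    (_hP : ∀ g : G, Nonempty ((Scheme.Modules.pullback
      (pullback.map A.X.hom D.hat.X.hom A.X.hom D.hat.X.hom (ρA.aut g).hom (ρh.aut g).hom (ρ.aut g).hom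
        (hA g).fst.symm (hAh g).fst.symm)).obj D.P ≅ D.P)),
    ∃ PB : (B.prodLeft Bh).Modules, HasRank PB 1 ∧
      Nonempty ((Scheme.Modules.pullback (B.unitSlice Bh)).obj PB ≅ SheafOfModules.unit _) ∧
      (∀ (Ω : Type) [Field Ω] [IsAlgClosed Ω] (b : Spec (.of Ω) ⟶ Bh.X.left),
        IsHomogeneous (B.fibre (b ≫ Bh.X.hom)).toAbelianVariety
          ((Scheme.Modules.pullback (B.fibreSlice Bh b)).obj PB)) ∧
      (∀ {T : Scheme.{0}} (f : T ⟶ Q) (ℒ : B.RigidifiedLineBundle f), ℒ.FibrewisePicZero →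
        ∃! g : {g : T ⟶ Bh.X.left // g ≫ Bh.X.hom = f},
          Nonempty ((Scheme.Modules.pullback (B.baseChangeToProd Bh f g.1 g.2)).obj PB ≅ ℒ.L)) ∧
      Nonempty ((Scheme.Modules.pullback
        (pullback.map A.X.hom D.hat.X.hom B.X.hom Bh.X.hom π πh p hAB.fst.symm hABh.fst.symm)).obj PB ≅ D.P) := by
  intro S Q p G _ _ ρ hq _ hfree A D B π ρA hAB hA Bh πh ρh hABh hAh _ _ _ _ hP
  exact AbelianSchemeOver.exists_dualPair_fields_of_free_base_quotient' hq hfree A D B ρA hAB hA Bh ρh hABh hAh hP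


/-! ## §3 THE (M) HEAD in any characteristic -/

/-- **(M) IN ANY CHARACTERISTIC — MUMFORD'S DUAL ABELIAN SCHEME OVER A CONNECTED NOETHERIAN AFFINE BASE** ([MumfordAV1970] §13 Theorem (p. 125):
`(A⁄K(L), 𝒫)` is the dual; [MumfordFogartyKirwan1994] Ch. 6 §1 Cor. 6.8 and §2 Prop. 6.13 (iii) for the relative form).  A PROJECTIVE abelian scheme
`A → Spec R` over a connected Noetherian ring, with `L` rank one rigidified along the unit section and of ample class on every geometric fibre, an exponent
`n ∈ R^×` and `K(L)` represented by a finite étale closed `i : Z ↪ A` with `i ^ n = 1`, and the `H¹`-count `hH1` at every field point of every base change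
([MumfordAV1970] §13 Cor. 2, carried as a hypothesis — road (A), heads (H-a)∕(H-b)), HAS A DUAL PAIR (★ `AbelianSchemeOver.DualPair`): (Ma) split `K(L)` over the
level cover `p : S′ → Spec R`, (Mb′) the quotient `(A ×_R S′)⁄K′` with its Poincaré sheaf, (Mc′) its universal property (★ `MumfordDual.existsUnique_classify`), then
descent along the free quotient `p` ((Md1)–(Md3)). [cite: MumfordAV1970, §13 Theorem (p. 125)] [cite: MumfordFogartyKirwan1994, Ch. 6 §1 Cor. 6.8 (p. 118) and §2 Prop. 6.13 (iii) (p. 123)] -/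
theorem nonempty_dualPair_of_isProjective_of_split (R : Type) [CommRing R] [IsNoetherianRing R] [ConnectedSpace ↥(Spec (.of R))]
    (A : AbelianSchemeOver (Spec (.of R))) (hA : IsProjective A.X.hom) (L : A.left.Modules) (hL : HasRank L 1)
    (hε : CechPic.pullback A.unitSection (detClass (HasRank.isFiniteLocallyFree' hL)) = 1)
    (hΘ : ∀ ⦃Ω : Type⦄ [Field Ω] [IsAlgClosed Ω] (s : Spec (.of Ω) ⟶ Spec (.of R)),
      ∃ Θ : CartierDivisor (A.fibre s).toAbelianVariety.X.left, Θ.IsAmple ∧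
        CechPic.pullback (X := (A.fibre s).toAbelianVariety.X.left) (pullback.fst A.X.hom s)
          (detClass (HasRank.isFiniteLocallyFree' hL)) = Θ.cechClass)
    (n : ℕ) [NeZero n] (hn : IsUnit ((n : ℕ) : R))
    (hK : ∃ (Z : Over (Spec (.of R))) (i : Z ⟶ A.X) (_ : IsClosedImmersion i.left) (_ : IsFinite Z.hom) (_ : Etale Z.hom),
      i ^ n = 1 ∧ ∀ (T : Over (Spec (.of R))) (u : T ⟶ A.X), (∃ v : T ⟶ Z, v ≫ i = u) ↔ A.MemKOfL L u)
    -- the `H¹`-count at every field point of every base change of `A` ([MumfordAV1970] §13 Cor. 2; discharged from the (H-b) head by the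
    -- DUALS letter, LA4-plan (g0) 2026-09-02T03:21:41Z (5))
    (hH1 : ∀ {S' : Scheme.{0}} (p : S' ⟶ Spec (.of R)) (K₁ : Type) [Field K₁] (s : Spec (.of K₁) ⟶ S') {J : Type} [Finite J]
      (U : J → ((A.baseChange p).X ⊗ Over.mk s).left.Opens), (∀ i, IsAffineOpen (U i)) → iSup U = ⊤ →
      Module.Finite K₁ (Literature.AlgebraicGeometry.Morphisms.CechH1 (X := ((A.baseChange p).X ⊗ Over.mk s).left)
        (Limits.pullback.snd (A.baseChange p).X.hom s) U) ∧
        Module.finrank K₁ (Literature.AlgebraicGeometry.Morphisms.CechH1 (X := ((A.baseChange p).X ⊗ Over.mk s).left)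
          (Limits.pullback.snd (A.baseChange p).X.hom s) U) = ((A.baseChange p).fibre s).toAbelianVariety.dim) :
    Nonempty A.DualPair := by
  classical
  obtain ⟨S', p, hS'aff, hS'noe, hpaff, hpfin, hplft, hpet, hpsurj, G, hGgrp, hGfin, ρ, ρA, hAB, hA₁, hq, hfree,
    K', hK'fin, hKinj, hK'⟩ := exists_split_kOfL_of_isUnit R A L hL hε hΘ n hn hK
  have hA' : IsProjective (A.baseChange p).X.hom := by
    rw [AbelianSchemeOver.baseChange_hom]; exact hA.pullback_snd p
  haveI : IsLocallyNoetherian S' := LocallyOfFiniteType.isLocallyNoetherian p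
  obtain ⟨hat, π, hπmon, hπfin, hπet, hπsurj, P, hker, h1, hrig, hpic, hsock, hfinaff⟩ :=
    A.exists_quotient_poincare_of_constant_kOfL_baseChange_of_isLocallyNoetherian hL hε p hA' K' hKinj hK'
  let D' : (A.baseChange p).DualPair :=
    ⟨hat, P, h1, hrig, hpic, fun f ℒ hℒ =>
      MumfordDual.existsUnique_classify R A L hL hε hΘ p (hH1 p) hat π ⟨hπfin, hπet, hπsurj⟩ P hker h1 hrig hsock f ℒ hℒ⟩
  let D : (A.baseChange p).DualPair := D'.normalize
  have hunit : Nonempty ((Scheme.Modules.pullback (AbelianSchemeOver.DualPair.unitHatSlice D)).obj D.P ≅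
      SheafOfModules.unit _) :=
    D'.nonempty_unitHatSlice_iso_normalize
  obtain ⟨ρh, hρh, hAh, hP⟩ := stub_F3Md1 ρ hq hfree (A.baseChange p) D A ρA hAB hA₁ hunit
  have hfinaff' : ∀ F : Finset D.hat.X.left, ∃ U : D.hat.X.left.Opens, IsAffineOpen U ∧ ∀ x ∈ F, x ∈ U := hfinaff
  obtain ⟨Bh, πh, hinv, hABh, hsep⟩ := stub_F3Md2 ρ hq hfree D.hat hfinaff' ρh hρh hAh
  haveI := hsep
  let ρh' : ActionOver πh G := ⟨ρh.aut, hinv⟩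
  obtain ⟨PB, hB1, hBrig, hBpic, hBuniv, -⟩ :=
    stub_F3Md3 hq hfree (A.baseChange p) D A ρA hAB hA₁ Bh ρh' hABh hAh hP
  exact ⟨⟨Bh, PB, hB1, hBrig, hBpic, fun f ℒ hℒ => hBuniv f ℒ hℒ⟩⟩


end MumfordDual

end Literature.AlgebraicGeometry.AbelianSchemes

end
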